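import Summits.AtomisticToContinuum.HydrodynamicLimit.Theorems.LambertianContactSwapLambertianEulerFwdGood
import HarnessLib

/-!
# Simplicity of the Lambertian collision process (crux `LambertianEuler`, stmt-AtomisticToContinuum-11854, line `Sketch`, stub `ae_freeExitTime_lambertStateAfter_pos`)

Support file (`--supports stmt-AtomisticToContinuum-11854`).  Registered sub-goal
`ae_freeExitTime_lambertStateAfter_pos` (E5 of lead c9): for `0 < σ < 1/2`, `N + 1` hard spheres of
diameter `ε_N = hsDiameter σ N` on `𝕋³`, and any finite law `P ≪ liouville`, for `P ⊗ γ^ℕ`-almost every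
pair `(z, ξs)` (datum, Gaussian noise) **every post-collisional state `z_k = lambertStateAfter G ε ξs z k`
of the Lambertian recursion has a positive free exit time** `0 < τ(z_k)`, `k ∈ ℕ` (including `z_0 = z`).
Consequently the collision instants `t_{k+1} = t_k + τ(z_k)` are strictly increasing while finite: the
Lambertian collision count is a simple point process.

## Proof

* `k = 0`: `liouville`-a.e. datum lies in the domain and in no contact set (the contact sets are
  Liouville-null hypersurfaces, `volume_contactSet`), so none of its contact pairs is incoming and
  `freeExitTime_pos` applies.
* `k + 1`: `z_{k+1} = lambertStep (ξs k) z_k` (`lambertStateAfter_succ`).  If `τ(z_k) = ∞` the step is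
  the identity and `τ(z_{k+1}) = ∞ > 0`.  Otherwise, by the landed a.e. forward regularity of the
  Lambertian flow (`…FwdGood.lambert_ae_fwdGood`, clause (1)) the exit configuration
  `y = S_{τ(z_k)} z_k` is a simple incoming collision configuration with colliding pair `p`, so the step
  redraws exactly that pair (`lambertStep_eq_lambertPair`), `z_{k+1} = lambertPair p y (ξs k)`.  The
  redraw does not move the particles, so the contact pairs of `z_{k+1}` are `p` and its swap, and the
  redrawn relative velocity `‖g‖ · lambertDir ω ξ` has `⟪ω, ‖g‖ lambertDir ω ξ⟫ ≥ 0`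
  (`inner_lambertDir_nonneg`): no contact pair of `z_{k+1}` is incoming, and `freeExitTime_pos` gives
  `τ(z_{k+1}) > 0`.
* Transfer from `liouville ⊗ γ^ℕ` to `P ⊗ γ^ℕ` by `Measure.AbsolutelyContinuous.prod`.

References: I. Gallagher, L. Saint-Raymond, B. Texier, *From Newton to Boltzmann* (EMS 2013), §4.1;
C. Cercignani, R. Illner, M. Pulvirenti, *The Mathematical Theory of Dilute Gases* (Springer 1994), App. 4.A.
-/

noncomputable section

open scoped BigOperators Topology ENNReal InnerProductSpace
open MeasureTheory ProbabilityTheory Filter Set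
open Literature.MathematicalPhysics.KineticTheory
open Literature.Analysis.FluidPDE Literature.Analysis.FluidPDE.Alexander

namespace Summit.AtomisticToContinuum.HydrodynamicLimit.Theorems.LambertianContactSwapLambertianEulerSimpleCollisions

/-! ## The Lambertian redraw of a simple incoming configuration has a positive exit time -/

section General

variable {d : Type*} [Fintype d] {X : Type*} {N : ℕ} {G : Geometry d X} {ε : ℝ}

/-- **The redrawn pair is never incoming**: after the Lambertian redraw of `(i, j)`,
`⟪ω, v_i' - v_j'⟫ = ‖v_i - v_j‖ ⟪ω, lambertDir ω ξ⟫ ≥ 0` (`inner_lambertDir_nonneg`). [folklore] -/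
theorem not_isIncoming_lambertPair {i j : Fin N} (hij : i ≠ j) (z : Config N d X)
    (ξ : EuclideanSpace ℝ d) : ¬IsIncoming G (lambertPair G i j z ξ) i j := by
  unfold IsIncoming
  rw [lambertPair_apply_fst, lambertPair_apply_fst, vel_sub_vel_lambertPair hij, inner_smul_right,
    not_lt]
  exact mul_nonneg (norm_nonneg _) (inner_lambertDir_nonneg _ _)

variable [TopologicalSpace X]

/-- **After the Lambertian redraw of the colliding pair of a simple incoming collision configuration,
no contact pair is incoming** (regular geometry: the contact pairs of the redrawn configuration are the
colliding pair and its swap, and "incoming" is symmetric in the pair at contact). [folklore] -/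
theorem not_isIncoming_lambertPair_of_isSimpleIncomingWith (hG : G.IsHardSphereRegular ε)
    {z : Config N d X} {p : Fin N × Fin N} (hp : IsSimpleIncomingWith G ε z p)
    (ξ : EuclideanSpace ℝ d) {i j : Fin N} (hij : i ≠ j)
    (hc : lambertPair G p.1 p.2 z ξ ∈ contactSet G N ε i j) :
    ¬IsIncoming G (lambertPair G p.1 p.2 z ξ) i j := by
  have hc' : z ∈ contactSet G N ε i j := (lambertPair_mem_contactSet_iff z ξ).1 hc
  rcases hp.eq_or_eq_of_mem_contactSet hij hc' with ⟨rfl, rfl⟩ | ⟨rfl, rfl⟩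
  · exact not_isIncoming_lambertPair hp.ne z ξ
  · have hle : ‖G.sepVec ((lambertPair G p.1 p.2 z ξ) p.1).1 ((lambertPair G p.1 p.2 z ξ) p.2).1‖ ≤ ε := by
      rw [lambertPair_apply_fst, lambertPair_apply_fst]
      exact hp.mem_contactSet.2.le
    rw [hG.isIncoming_comm hle]
    exact not_isIncoming_lambertPair hp.ne z ξ

/-- **After the Lambertian redraw of a simple incoming collision configuration the exit time is
positive** (the Lambertian analogue of `IsSimpleIncomingWith.freeExitTime_collidePair_pos`). [folklore] -/
theorem freeExitTime_lambertPair_pos (hG : G.IsHardSphereRegular ε) {z : Config N d X}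
    {p : Fin N × Fin N} (hp : IsSimpleIncomingWith G ε z p) (ξ : EuclideanSpace ℝ d) :
    0 < freeExitTime G ε (lambertPair G p.1 p.2 z ξ) :=
  freeExitTime_pos hG ((lambertPair_mem_hardSphereDomain_iff z ξ).2 hp.mem_hardSphereDomain)
    fun _ _ hij hc => not_isIncoming_lambertPair_of_isSimpleIncomingWith hG hp ξ hij hc

/-- **The Lambertian step lands on a state of positive exit time** as soon as the exit configuration
of the starting state, if reached in finite time, is a simple incoming collision configuration: either
`τ(z) = ∞` and the step is the identity, or the step redraws the colliding pair of the exit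
configuration (`lambertStep_eq_lambertPair`) and `freeExitTime_lambertPair_pos` applies. [folklore] -/
theorem freeExitTime_lambertStep_pos (hG : G.IsHardSphereRegular ε) {z : Config N d X}
    (h : freeExitTime G ε z ≠ ∞ → IsSimpleIncoming G ε (freeFlight G (freeExitTime G ε z).toReal z))
    (ξ : EuclideanSpace ℝ d) : 0 < freeExitTime G ε (lambertStep G ε ξ z) := by
  by_cases hτ : freeExitTime G ε z = ∞
  · rw [lambertStep_of_eq_top hτ, hτ]
    exact ENNReal.zero_lt_top
  · obtain ⟨p, hp⟩ := isSimpleIncoming_iff.1 (h hτ)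
    rw [lambertStep_eq_lambertPair hτ hp.incomingPairs_eq]
    exact freeExitTime_lambertPair_pos hG hp ξ

/-- **Pointwise form of the stub**: if `z` lies in the domain and in no contact set, and every finite
exit configuration of the Lambertian recursion from `(z, ξs)` is a simple incoming collision
configuration, then every post-collisional state `z_k` has a positive exit time. [folklore] -/
theorem freeExitTime_lambertStateAfter_pos (hG : G.IsHardSphereRegular ε) {z : Config N d X}
    (hz : z ∈ hardSphereDomain G N ε) (hzc : ∀ i j : Fin N, i ≠ j → z ∉ contactSet G N ε i j)
    {ξs : ℕ → EuclideanSpace ℝ d}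
    (h : ∀ k, freeExitTime G ε (lambertStateAfter G ε ξs z k) ≠ ∞ →
      IsSimpleIncoming G ε (freeFlight G (freeExitTime G ε (lambertStateAfter G ε ξs z k)).toReal
        (lambertStateAfter G ε ξs z k)))
    (k : ℕ) : 0 < freeExitTime G ε (lambertStateAfter G ε ξs z k) := by
  induction k with
  | zero => exact freeExitTime_pos hG hz fun i j hij hc _ => hzc i j hij hc
  | succ k _ =>
    rw [lambertStateAfter_succ]
    exact freeExitTime_lambertStep_pos hG (h k) (ξs k)

end General

/-! ## The registered sub-goal on `𝕋³` -/

/-- `liouville`-almost every datum of the torus phase space lies in the hard-sphere domain and in no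
contact set (`ε ≠ 0`; the contact sets are Liouville-null, `volume_contactSet`). [folklore] -/
theorem ae_liouville_mem_and_not_mem_contactSet {N : ℕ} {ε : ℝ} (hε : ε ≠ 0) :
    ∀ᵐ z ∂(liouville (Torus.geometry (Fin 3)) N ε),
      z ∈ hardSphereDomain (Torus.geometry (Fin 3)) N ε ∧
        ∀ i j : Fin N, i ≠ j → z ∉ contactSet (Torus.geometry (Fin 3)) N ε i j := by
  have hD : MeasurableSet (hardSphereDomain (Torus.geometry (Fin 3)) N ε) :=
    measurableSet_hardSphereDomain _ Torus.measurable_geometry_sepVec N ε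
  rw [liouville_eq]
  refine (ae_restrict_mem hD).and (ae_restrict_of_ae ?_)
  refine ae_all_iff.2 fun i => ae_all_iff.2 fun j => ?_
  by_cases hij : i = j
  · exact Eventually.of_forall fun _ h => (h hij).elim
  · filter_upwards [measure_eq_zero_iff_ae_notMem.1 (volume_contactSet (d := Fin 3) hε hij)] with z hz _
    exact hz

/-- **Registered sub-goal `ae_freeExitTime_lambertStateAfter_pos`** (E5 of lead c9, line `Sketch` of the
crux `LambertianContactSwap.LambertianEuler`): **simplicity of the Lambertian collision process** — for
`0 < σ < 1/2`, `N`, and a finite law `P ≪ liouville` of `N + 1` spheres of diameter `hsDiameter σ N` on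
`𝕋³`, for `P ⊗ γ^ℕ`-almost every pair (datum, noise) every post-collisional state of the Lambertian
recursion has a positive free exit time (so the collision instants are strictly increasing while
finite).  From the a.e. forward regularity of the Lambertian flow (`lambert_ae_fwdGood`, clause (1):
finite exit configurations are simple incoming), the null contact sets for `k = 0`, the pointwise step
`freeExitTime_lambertStateAfter_pos`, and the transfer `P ⊗ γ^ℕ ≪ liouville ⊗ γ^ℕ`.
[cite: GST2013, proof of Prop. 4.1.1 p. 19] -/
theorem ae_freeExitTime_lambertStateAfter_pos :
    ∀ {σ : ℝ}, 0 < σ → σ < 2⁻¹ → ∀ (N : ℕ) (P : Measure (Config (N + 1) (Fin 3) T3)) [IsFiniteMeasure P],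
      P ≪ liouville (Torus.geometry (Fin 3)) (N + 1) (hsDiameter σ N) →
        ∀ᵐ p ∂(P.prod (lambertNoise (Fin 3))), ∀ k : ℕ,
          0 < freeExitTime (Torus.geometry (Fin 3)) (hsDiameter σ N)
            (lambertStateAfter (Torus.geometry (Fin 3)) (hsDiameter σ N) p.2 p.1 k) := by
  intro σ hσ hσ' N P _ hP
  have hε : 0 < hsDiameter σ N := hsDiameter_pos hσ N
  have hε' : hsDiameter σ N < 2⁻¹ := (hsDiameter_le hσ.le N).trans_lt hσ'
  have hG := Torus.isHardSphereRegular_geometry (d := Fin 3) hε'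
  have key : ∀ᵐ p ∂((liouville (Torus.geometry (Fin 3)) (N + 1) (hsDiameter σ N)).prod (lambertNoise (Fin 3))),
      ∀ k : ℕ, 0 < freeExitTime (Torus.geometry (Fin 3)) (hsDiameter σ N)
        (lambertStateAfter (Torus.geometry (Fin 3)) (hsDiameter σ N) p.2 p.1 k) := by
    have h0 := (Measure.quasiMeasurePreserving_fst
      (μ := liouville (Torus.geometry (Fin 3)) (N + 1) (hsDiameter σ N)) (ν := lambertNoise (Fin 3))).ae
      (ae_liouville_mem_and_not_mem_contactSet (N := N + 1) hε.ne')
    filter_upwards [LambertianContactSwapLambertianEulerFwdGood.lambert_ae_fwdGood hε hε' (N := N + 1), h0]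
      with p hp hp0
    exact freeExitTime_lambertStateAfter_pos hG hp0.1 hp0.2 hp.1
  exact (hP.prod Measure.AbsolutelyContinuous.rfl).ae_le key

end Summit.AtomisticToContinuum.HydrodynamicLimit.Theorems.LambertianContactSwapLambertianEulerSimpleCollisions

end
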